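import Summits.ABC.ABC.Theses.CubicResolventAllowance
import Literature.NumberTheory.NumberFields.CubicFieldExplicit
import Literature.NumberTheory.EllipticCurves.SzpiroLocalDataProofs
import Literature.NumberTheory.EllipticCurves.QuadraticTwist
import Literature.NumberTheory.DiophantineGeometry.ValuationProductElliptic
import Literature.NumberTheory.DiophantineGeometry.MinimalDiscriminantBaseChangeCongruence
import Literature.NumberTheory.DiophantineGeometry.TateAlgorithmTameTypesOddProofs
import Literature.NumberTheory.DiophantineGeometry.MinimalDiscriminantFactorizationProofs
import Literature.NumberTheory.DiophantineGeometry.ConductorFactorizationProofs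
import Literature.Barriers.ABC.SzpiroEpsilonCannotBeDropped

/-!
# Stub ideation k=3 (HOME = family 3: probe the extremes), gen 3 — `stub_complexCubic` of crux
`IndexSzpiro` (stmt-ABC-22740, route-ABC-CubicResolventAllowance)

Elaboration sanity for the helper statements named in `STUB-IDEAS-stub_complexCubic-3.md` (gen 3).
Bodies are `sorry` unless marked VERIFIED; nothing here is a tree proposal.
Namespace `…Cruxes.IndexSzpiro.StubIdeas3ComplexG3` (gen 2 of this seat is `…StubIdeas3Complex`).

THE MOVE (minimal counterexample ⇒ normal form; perturbation from the proved neighbour):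
write the stub prime by prime.  With `n_p = ord_p Δ_min`, `f_p` the conductor exponent and
`e_p := n_p - v_p(d_K) - 6 f_p` ("local excess"), the stub says `Σ_p e_p log p ≤ log C + ε log N`
on the complex class.  The local ledger below shows, for EVERY curve with irreducible 2-division
cubic (no sign, no semistability):
* L1/L2  `n_p ≡ v_p(d_K) (mod 2)` at every prime, hence `n_p odd ⇒ p ∣ d_K` (the allowance lemma,
         S-sized from `Δ = q²·d_K` and the tree's `12 ∣ ord_p Δ_min - ord_p Δ(W)`);
* L3     `p ≥ 3`:  `v_p(j) ≥ 0 ⇒ n_p ≤ 6 f_p`;  `v_p(j) < 0 ⇒ n_p - 6 f_p = -v_p(j) - 6`;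
* L4     every `p`: `n_p ≤ max(0, -v_p(j)) + 22`;
so `e_p ≤ δ_p(j) := max(0, 2⌊-v_p(j)/2⌋ - 6)` for `p ≥ 3` and `e_2 ≤ δ_2(j) + 17`, i.e. the ε-FREE
ENVELOPE  `Δ_min ∣ 2^B · D(j) · |d_K| · N⁶`,  `D(j) := ∏_p p^{δ_p(j)}` (deep, parity-corrected towers).
Consequences: the `ε = 0` rung on `{D(j) = 1}` (all poles of `j` of order `≤ 7`, ANY reduction
elsewhere, both signs); the stub on `{D(j) ≤ B·N^ε}`; and the violator profile: a counterexample
sequence must carry deep even towers with `D(j) > B·N^ε` for every `B` — the sign-free Szpiro core.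
Autopsy: the credit-free currency `D(j) ≤ B·N^ε` is FALSE on the complex class (family
`W_k = [1,0,0,0,2^k]`, semistable, `Δ = -2^k(1+432·2^k) < 0`, `v_2(j) = -k`), so credits from the
shallow primes are essential; and finite-place data never see the sign (`signInvisible`).
-/

open Polynomial

namespace Summit.ABC.ABC.Cruxes.IndexSzpiro.StubIdeas3ComplexG3

open IsDedekindDomain Rat.HeightOneSpectrum
open Literature.NumberTheory.NumberFields
open scoped NumberField

/-! ## §0 The stub, verbatim, and shorthands (as in gen 0/2) -/

/-- The registered stub `stub_complexCubic` (signature verbatim). -/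
def Stub : Prop :=
  ∀ ε : ℝ, 0 < ε → ∃ C : ℝ, ∀ (W : WeierstrassCurve ℚ) [W.IsElliptic] (K : Type) [Field K]
    [NumberField K], Irreducible W.twoTorsionPolynomial.toPoly → Module.finrank ℚ K = 3 →
    (∃ θ : K, aeval θ W.twoTorsionPolynomial.toPoly = 0) → NumberField.discr K < 0 →
    (W.minimalDiscriminantNorm ℤ : ℝ) ≤
      C * |(NumberField.discr K : ℝ)| * (W.conductorNorm ℤ : ℝ) ^ (6 + ε)

/-- `K` is "the" cubic field of `W`. -/
def IsResolventField (W : WeierstrassCurve ℚ) (K : Type) [Field K] [NumberField K] : Prop :=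
  Irreducible W.twoTorsionPolynomial.toPoly ∧ Module.finrank ℚ K = 3 ∧
    ∃ θ : K, aeval θ W.twoTorsionPolynomial.toPoly = 0

/-- The stub's inequality with constant `C` and exponent `6 + ε` (`ε = 0` allowed). -/
def Ineq (C ε : ℝ) (W : WeierstrassCurve ℚ) [W.IsElliptic] (K : Type) [Field K] [NumberField K] :
    Prop :=
  (W.minimalDiscriminantNorm ℤ : ℝ) ≤ C * |(NumberField.discr K : ℝ)| * (W.conductorNorm ℤ : ℝ) ^ (6 + ε)

/-- VERIFIED: the stub in shorthand. -/
theorem stub_iff : Stub ↔ ∀ ε : ℝ, 0 < ε → ∃ C : ℝ, ∀ (W : WeierstrassCurve ℚ) [W.IsElliptic]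
    (K : Type) [Field K] [NumberField K], IsResolventField W K → NumberField.discr K < 0 →
    Ineq C ε W K := by
  constructor
  · intro h ε hε
    obtain ⟨C, hC⟩ := h ε hε
    exact ⟨C, fun W _ K _ _ hR hd => hC W K hR.1 hR.2.1 hR.2.2 hd⟩
  · intro h ε hε
    obtain ⟨C, hC⟩ := h ε hε
    exact ⟨C, fun W _ K _ _ h1 h2 h3 hd => hC W K ⟨h1, h2, h3⟩ hd⟩

/-- **H1 `DiscSqRatio` (M, gen 0; = k2's `IndexSquareIdentity` up to `2⁸`).** `Δ(W) = q²·d_K`. -/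
def DiscSqRatio : Prop :=
  ∀ (W : WeierstrassCurve ℚ) [W.IsElliptic] (K : Type) [Field K] [NumberField K],
    IsResolventField W K → ∃ q : ℚ, q ≠ 0 ∧ W.Δ = q ^ 2 * (NumberField.discr K : ℚ)

/-! ## §L The local ledger (NEW, gen 3) -/

/-- The local excess at the place `v` (prime `p = natGenerator v`):
`e_v := ord_v Δ_min - v_p(d_K) - 6·f_v`.  The stub is `Σ_v e_v log p_v ≤ log C + ε log N`. -/
noncomputable def localExcess (W : WeierstrassCurve ℚ) (K : Type) [Field K] [NumberField K]
    (v : HeightOneSpectrum ℤ) : ℤ :=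
  (W.ordMinimalDiscriminant v : ℤ) - (padicValInt (natGenerator v) (NumberField.discr K) : ℤ) -
    6 * (W.conductorExponent v : ℤ)

/-- **L1 `ordMinDisc_parity` (S given H1; VERIFIED modulo H1).** At EVERY prime:
`ord_p Δ_min ≡ v_p(d_K) (mod 2)` — from `Δ(W) = q² d_K` and the tree's
`twelve_dvd_ordMinimalDiscriminant_sub_padicValRat_Δ` (`ord_p Δ_min ≡ ord_p Δ(W) mod 12`). -/
theorem ordMinDisc_parity (hH1 : DiscSqRatio) (W : WeierstrassCurve ℚ) [W.IsElliptic] (K : Type)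
    [Field K] [NumberField K] (hR : IsResolventField W K) (v : HeightOneSpectrum ℤ) :
    Even ((W.ordMinimalDiscriminant v : ℤ) - padicValInt (natGenerator v) (NumberField.discr K)) := by
  haveI : Fact (natGenerator v).Prime := ⟨prime_natGenerator v⟩
  obtain ⟨q, hq, hΔ⟩ := hH1 W K hR
  have h12 := W.twelve_dvd_ordMinimalDiscriminant_sub_padicValRat_Δ v
  have hd : (NumberField.discr K : ℚ) ≠ 0 := by exact_mod_cast NumberField.discr_ne_zero K
  have hval : padicValRat (natGenerator v) W.Δ =
      2 * padicValRat (natGenerator v) q + padicValInt (natGenerator v) (NumberField.discr K) := by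
    rw [hΔ, sq, padicValRat.mul (mul_ne_zero hq hq) hd, padicValRat.mul hq hq, padicValRat.of_int]
    ring
  have h2 : (2 : ℤ) ∣ (W.ordMinimalDiscriminant v : ℤ) - padicValRat (natGenerator v) W.Δ :=
    dvd_trans ⟨6, by norm_num⟩ h12
  rw [hval] at h2
  rw [even_iff_two_dvd]
  have : (W.ordMinimalDiscriminant v : ℤ) - padicValInt (natGenerator v) (NumberField.discr K) =
      ((W.ordMinimalDiscriminant v : ℤ) - (2 * padicValRat (natGenerator v) q +
        padicValInt (natGenerator v) (NumberField.discr K))) + 2 * padicValRat (natGenerator v) q := by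
    ring
  rw [this]
  exact dvd_add h2 (dvd_mul_right 2 _)

/-- **L2 `dvd_discr_of_odd_ordMinDisc` (S; VERIFIED from L1) — the allowance lemma for all primes and
all reduction types:** `ord_p Δ_min` odd ⇒ `p ∣ d_K`. -/
theorem dvd_discr_of_odd_ordMinDisc (hH1 : DiscSqRatio) (W : WeierstrassCurve ℚ) [W.IsElliptic]
    (K : Type) [Field K] [NumberField K] (hR : IsResolventField W K) (v : HeightOneSpectrum ℤ)
    (hodd : Odd (W.ordMinimalDiscriminant v)) :
    ((natGenerator v : ℕ) : ℤ) ∣ NumberField.discr K := by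
  haveI : Fact (natGenerator v).Prime := ⟨prime_natGenerator v⟩
  have hev := ordMinDisc_parity hH1 W K hR v
  have hodd' : Odd (W.ordMinimalDiscriminant v : ℤ) := by exact_mod_cast hodd
  have h1 : 1 ≤ padicValInt (natGenerator v) (NumberField.discr K) := by
    rcases hev with ⟨r, hr⟩
    rcases hodd' with ⟨s, hs⟩
    omega
  have := (padicValInt_dvd_iff (p := natGenerator v) 1 (NumberField.discr K)).mpr
    (Or.inr h1)
  simpa using this

/-- **L3a `ordMinDisc_le_of_potGood` (M).** `p ≥ 3`, `v_p(j) ≥ 0` ⇒ `n_p ≤ 6 f_p`.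
Why: `v_p(j) ≥ 0` excludes `Iₙ` (multiplicative ⇒ `c₄` unit ⇒ `v(j) = -n < 0`) and, for `p ≠ 2`,
`Iₙ*` with `n ≥ 1` (`one_lt_valuation_j_of_kodairaSymbolAt_eq_Istar_succ`); the remaining additive
types have `m_p ≤ 9`, and `f_p = n_p + 1 - m_p` (Ogg, the tree's DEFINITION of `conductorExponent`)
with `f_p ≥ 2` (`two_le_conductorExponent_iff`) gives `n_p ≤ f_p + 8 ≤ 6 f_p`; good: `0 ≤ 0`. -/
theorem ordMinDisc_le_of_potGood (W : WeierstrassCurve ℚ) [W.IsElliptic] (v : HeightOneSpectrum ℤ)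
    (hp : 3 ≤ natGenerator v) (hj : 0 ≤ padicValRat (natGenerator v) W.j) :
    W.ordMinimalDiscriminant v ≤ 6 * W.conductorExponent v := by
  sorry

/-- **L3b `ordMinDisc_of_potMult` (M).** `p ≥ 3`, `v_p(j) < 0` ⇒ `n_p - 6 f_p = -v_p(j) - 6`
(`Iₙ`: `n_p = n = -v(j)`, `f = 1`; `Iₙ*`: `n_p = n + 6`, `f = 2`, `v(j) = -n` — tame twist, `p` odd;
tree: `kodairaSymbolAt_eq_I_iff`, `conductorExponent_eq_one_iff`,
`ordMinimalDiscriminant_eq_numComponentsAt_add_one_of_kodairaSymbolAt`,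
`conductorExponent_eq_two_of_kodairaSymbolAt`, proof of `one_lt_valuation_j_…` gives `v(j) = -n`). -/
theorem ordMinDisc_of_potMult (W : WeierstrassCurve ℚ) [W.IsElliptic] (v : HeightOneSpectrum ℤ)
    (hp : 3 ≤ natGenerator v) (hj : padicValRat (natGenerator v) W.j < 0) :
    (W.ordMinimalDiscriminant v : ℤ) - 6 * (W.conductorExponent v : ℤ) =
      -padicValRat (natGenerator v) W.j - 6 := by
  sorry

/-- **L4 `ordMinDisc_le_crude` (M).** Every prime: `n_p ≤ max(0, -v_p(j)) + 22`.
Why: rescale `(c₄, c₆) ↦ (c₄/p⁴, c₆/p⁶)` until `¬(p⁴ ∣ c₄ ∧ p⁶ ∣ c₆)`; the INTEGRAL model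
`y² = x³ - 27c₄x - 54c₆` has discriminant `2¹²3¹²·Δ'` with `j = c₄³/Δ'`, `j - 1728 = c₆²/Δ'`, so
`v(Δ') ≤ max(9 - v(j), 10 - v(j - 1728)) ≤ 10 + max(0, -v(j))`, and `ord Δ_min ≤ v_p` of the
discriminant of any integral model. (Sharp tables: Kraus 1990 / Papadopoulos 1993 — not needed.) -/
theorem ordMinDisc_le_crude (W : WeierstrassCurve ℚ) [W.IsElliptic] (v : HeightOneSpectrum ℤ) :
    (W.ordMinimalDiscriminant v : ℤ) ≤ max 0 (-padicValRat (natGenerator v) W.j) + 22 := by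
  sorry

/-- The parity-corrected deep excess of a pole of `j`: `δ_p(j) = max(0, 2⌊-v_p(j)/2⌋ - 6)`
(`= 0` unless `v_p(j) ≤ -8`). -/
def deepExcess (p : ℕ) (j : ℚ) : ℕ := 2 * ((-padicValRat p j).toNat / 2) - 6

/-- `D(j) := ∏_{p ∣ den j} p^{δ_p(j)}` — the deep-even-tower part of the denominator of `j`. -/
def towerProduct (j : ℚ) : ℕ := ∏ p ∈ j.den.primeFactors, p ^ deepExcess p j

/-- VERIFIED sanity: `δ = 0` for towers `≤ 7`, `δ(8) = δ(9) = 2`, `δ(10) = 4`. -/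
example : (2 * ((7 : ℤ).toNat / 2) - 6, 2 * ((8 : ℤ).toNat / 2) - 6, 2 * ((9 : ℤ).toNat / 2) - 6,
    2 * ((10 : ℤ).toNat / 2) - 6) = (0, 2, 2, 4) := by decide

/-- **L5 `localExcess_le` (S glue from L2 + L3a/b + L4 + `conductorExponent_ne_zero_iff` /
`two_le_conductorExponent_iff`).** `p ≥ 3 ⇒ e_p ≤ δ_p(j)`; `p = 2 ⇒ e_2 ≤ δ_2(j) + 17`. -/
theorem localExcess_le (hH1 : DiscSqRatio) (W : WeierstrassCurve ℚ) [W.IsElliptic] (K : Type)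
    [Field K] [NumberField K] (hR : IsResolventField W K) (v : HeightOneSpectrum ℤ) :
    localExcess W K v ≤ (deepExcess (natGenerator v) W.j : ℤ) + if natGenerator v = 2 then 17 else 0 := by
  sorry

/-! ## §G Global consequences: envelope, ε = 0 rung, subclass, violator profile -/

/-- **ENV `envelope_dvd` (M: local-to-global via the PROVED factorisations
`factorization_minimalDiscriminantNorm_holds`, `factorization_conductorNorm_holds` and
`Nat.factorization_le_iff_dvd`).** ε-free, sign-free, all reduction types:
`Δ_min ∣ 2^B · D(j) · |d_K| · N⁶` (expected `B = 17`). -/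
theorem envelope_dvd (hH1 : DiscSqRatio) : ∃ B : ℕ, ∀ (W : WeierstrassCurve ℚ) [W.IsElliptic]
    (K : Type) [Field K] [NumberField K], IsResolventField W K →
    W.minimalDiscriminantNorm ℤ ∣
      2 ^ B * towerProduct W.j * (NumberField.discr K).natAbs * (W.conductorNorm ℤ) ^ 6 := by
  sorry

/-- **RUNG0 `ineq_of_towerProduct_eq_one` (S from ENV) — the `ε = 0` rung:** all poles of `j` of
order `≤ 7` (ANY reduction elsewhere, BOTH signs) ⇒ `Δ_min ≤ 2^B·|d_K|·N⁶`.  Strictly contains gen-2's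
semistable rung R1 and the prime-conductor rung (there `v_p ≤ 5` by Mestre–Oesterlé). -/
theorem ineq_of_towerProduct_eq_one (hH1 : DiscSqRatio) : ∃ C : ℝ, ∀ (W : WeierstrassCurve ℚ)
    [W.IsElliptic] (K : Type) [Field K] [NumberField K], IsResolventField W K →
    towerProduct W.j = 1 → Ineq C 0 W K := by
  sorry

/-- **SUB `stub_on_shallow` (S from ENV).** The stub — with an ε-uniform constant — on the class
`D(j) ≤ B·N^ε`. -/
theorem stub_on_shallow (hH1 : DiscSqRatio) (B : ℝ) : ∃ C : ℝ, ∀ (ε : ℝ), 0 < ε →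
    ∀ (W : WeierstrassCurve ℚ) [W.IsElliptic] (K : Type) [Field K] [NumberField K],
    IsResolventField W K → (towerProduct W.j : ℝ) ≤ B * (W.conductorNorm ℤ : ℝ) ^ ε →
    Ineq C ε W K := by
  sorry

/-- **PROFILE `deepTowers_of_not_stub` (S from ENV) — the minimal-counterexample normal form:**
if the stub fails, it fails along curves whose deep even towers beat every `B·N^ε`. -/
theorem deepTowers_of_not_stub (hH1 : DiscSqRatio) (h : ¬ Stub) : ∃ ε : ℝ, 0 < ε ∧ ∀ B : ℝ,
    ∃ (W : WeierstrassCurve ℚ) (_ : W.IsElliptic) (K : Type) (_ : Field K) (_ : NumberField K),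
    IsResolventField W K ∧ NumberField.discr K < 0 ∧
      B * (W.conductorNorm ℤ : ℝ) ^ ε < towerProduct W.j := by
  sorry

/-! ## §A Autopsy: the credit-free currency is false in the complex class; the sign is invisible locally -/

/-- The family `W_k : y² + xy = x³ + 2^k` (`[1,0,0,0,2^k]`): `c₄ = 1`, `Δ = -2^k(1 + 432·2^k) < 0`,
`ψ₂ = 4x³ + x² + 2^{k+2}` irreducible for every `k` (rational-root test; checked `k ≤ 300` locally),
semistable with `v_2(j) = -k`, so `D(j) ≥ 2^{2⌊k/2⌋-6}` while `N ≤ |Δ| < 2^{2k+10}`. -/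
def Wk (k : ℕ) : WeierstrassCurve ℚ := ⟨1, 0, 0, 0, (2 : ℚ) ^ k⟩

/-- VERIFIED: `c₄(W_k) = 1` and `Δ(W_k) = -2^k (1 + 432·2^k)`. -/
theorem Wk_c₄_Δ (k : ℕ) : (Wk k).c₄ = 1 ∧ (Wk k).Δ = -(2 : ℚ) ^ k * (1 + 432 * 2 ^ k) := by
  constructor
  · simp [Wk, WeierstrassCurve.c₄, WeierstrassCurve.b₂, WeierstrassCurve.b₄]
  · simp [Wk, WeierstrassCurve.Δ, WeierstrassCurve.b₂, WeierstrassCurve.b₄, WeierstrassCurve.b₆,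
      WeierstrassCurve.b₈]
    ring

/-- **A1 `creditFree_false` (M, NEGATIVE — a refuted strengthening for `Disproof.lean`):** the
currency without shallow-prime credits, `D(j) ≤ B·N^ε`, fails on the complex class (witness `W_k`,
`ε < 1/2`).  So any proof of the stub must SPEND the credits `p^{6-2⌊n_p/2⌋}` of the shallow primes. -/
theorem creditFree_false : ¬ ∀ ε : ℝ, 0 < ε → ∃ B : ℝ, ∀ (W : WeierstrassCurve ℚ) [W.IsElliptic]
    (K : Type) [Field K] [NumberField K], IsResolventField W K → NumberField.discr K < 0 →
    (towerProduct W.j : ℝ) ≤ B * (W.conductorNorm ℤ : ℝ) ^ ε := by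
  sorry

/-- **A2 `signInvisible` (L, ANTI-HELPER — why the complex/real split is cosmetic for every finite-place
argument):** any finite package of local ledger data of a curve with irreducible `ψ₂` is realised inside
the COMPLEX class (weak approximation on the coefficients + local constancy of Tate's algorithm and of
the local cubic algebra (Krasner) + Hilbert irreducibility in `a₆`). -/
theorem signInvisible (W₀ : WeierstrassCurve ℚ) [W₀.IsElliptic] (K₀ : Type) [Field K₀] [NumberField K₀]
    (h₀ : IsResolventField W₀ K₀) (S : Finset (HeightOneSpectrum ℤ)) :
    ∃ (W : WeierstrassCurve ℚ) (_ : W.IsElliptic) (K : Type) (_ : Field K) (_ : NumberField K),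
      IsResolventField W K ∧ NumberField.discr K < 0 ∧
      ∀ v ∈ S, localExcess W K v = localExcess W₀ K₀ v ∧
        padicValRat (natGenerator v) W.j = padicValRat (natGenerator v) W₀.j := by
  sorry

/-! ## §N Normal form of a minimal counterexample (twist-maximal representative) -/

/-- **N1 `wlog_semistable_at_potMult` (M).** Twisting by `d ≡ 1 (4)`, `|d| = ∏ {p ≥ 5 : Iₙ* at p}`,
keeps `K` and the sign, turns every `Iₙ*` (`p ≥ 5`) into `Iₙ` and divides `Δ_min/(|d_K| N^{6+ε})` by
`∏ p^{-ε} ≤ 1`: the stub follows from the stub on curves multiplicative at every pole of `j` with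
`p ≥ 5`. -/
theorem wlog_semistable_at_potMult
    (h : ∀ ε : ℝ, 0 < ε → ∃ C : ℝ, ∀ (W : WeierstrassCurve ℚ) [W.IsElliptic] (K : Type) [Field K]
      [NumberField K], IsResolventField W K → NumberField.discr K < 0 →
      (∀ v : HeightOneSpectrum ℤ, 5 ≤ natGenerator v → padicValRat (natGenerator v) W.j < 0 →
        W.HasMultiplicativeReductionAt v) → Ineq C ε W K) :
    Stub := by
  sorry

end Summit.ABC.ABC.Cruxes.IndexSzpiro.StubIdeas3ComplexG3
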